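import Summits.CriticalPhenomena.Ising3DConformalLimit.Theses.LeeYangGap
import Summits.CriticalPhenomena.Ising3DConformalLimit.Theses.IsingEuclidUpgrade
import Summits.CriticalPhenomena.Ising3DConformalLimit.Theorems.PerfectScreeningCoulombImpliesNontrivialGapOfBinder
import Summits.CriticalPhenomena.Ising3DConformalLimit.Theorems.PerfectScreeningCoulombImpliesNontrivialOfLeeYangGap

/-!
# Strategy census `s1` for crux `NearCriticalLeeYangGap` (stmt-CriticalPhenomena-4945) — typed companion

Planner / crux-strategist scratch file (census family `s`, second independent census). Nothing here is a
route item. It records, kernel-checked where cheap: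

* `gap_iff_binderNonvanishing` — the WATERSHED EQUIVALENCE already in the tree (two theorems of the
  `PerfectScreening` line `SketchPub`): the crux is literally "the critical block Binder cumulant
  `g_L = (3Σ_L² − ⟨M_L⁴⟩)/Σ_L²` does not tend to `0`", i.e. non-vanishing of the dimensionless renormalised
  coupling of nearest-neighbour Ising on `ℤ³` at `β_c` along a subsequence of blocks;
* the candidate replacements examined in `STRATEGY-CENSUS-s1.md`, as `Prop`s over tree vocabulary, so that
  the census's "no leverage" verdicts refer to precise statements:
  `UniformBlockGap` (strengthen S⁺), `BlockGapDoublingLoss` / `BlockGapContraction` (what volume-antitonicity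
  gives vs. what an induction on scales would need), `PointwiseU4Hyperscaling` (the lattice, pointwise form of
  clause (iii) — other routes' crux content), `SusceptibilityTopHeavyFrequently` (one-scale side condition),
  `NonGaussianLimitForcesGap` (the converse of item 4950: why no (iii)-supplier is weaker than the crux modulo
  the route's residual), and the by-name pointer `ConditionalNonGaussianity := IsingEuclidUpgradeR4NonGaussian`
  (stmt-0636, the strictly-weaker-but-conditional intermediate, wanted by ~25 routes).
-/

noncomputable section

namespace Summit.CriticalPhenomena.Ising3DConformalLimit.Cruxes.NearCriticalLeeYangGap.CensusS1

open Literature.Probability.LatticeModels Filter Set Finset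
open scoped Topology BigOperators

/-- Block variance `Σ_L = ⟨M_L²⟩⁺_{β_c(3)}`, `M_L = Σ_{x ∈ box 3 L} σ_x`. [folklore] -/
def blockVar (L : ℕ) : ℝ :=
  plusExpect 3 (criticalBeta 3) 0 (fun σ => (∑ x ∈ box 3 L, spinAt x σ) ^ 2)

/-- Block fourth moment `⟨M_L⁴⟩⁺_{β_c(3)}`. [folklore] -/
def blockFourth (L : ℕ) : ℝ :=
  plusExpect 3 (criticalBeta 3) 0 (fun σ => (∑ x ∈ box 3 L, spinAt x σ) ^ 4)

/-- Critical block Binder cumulant / dimensionless renormalised coupling `g_L = (3Σ_L² − ⟨M_L⁴⟩)/Σ_L² ∈ [0,2]`. [folklore] -/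
def binder (L : ℕ) : ℝ :=
  (3 * blockVar L ^ 2 - blockFourth L) / blockVar L ^ 2

/-- **Watershed equivalence (in tree).** The crux `NearCriticalLeeYangGap` holds iff the critical block Binder
cumulant does not tend to zero. `→`: `sketchPub_binderNonvanishing_of_nearCriticalLeeYangGap` (CJN β-antitonicity
items 4947/4948 + Newman's first-zero bound 4949); `←`: `stub_gapOfBinderNonvanishing` (Newman's Lee–Yang
inequalities give a zero `θ₁` with `θ₁²Σ_L ≤ 3π²/(2ε)` whenever `g_L ≥ ε`). [folklore] -/
theorem gap_iff_binderNonvanishing :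
    Summit.CriticalPhenomena.Ising3DConformalLimit.Theses.LeeYangGap.NearCriticalLeeYangGap ↔
      ¬ Tendsto binder atTop (𝓝 0) :=
  ⟨fun h => Summit.CriticalPhenomena.Ising3DConformalLimit.PerfectScreeningCoulombImpliesNontrivial.sketchPub_binderNonvanishing_of_nearCriticalLeeYangGap h,
   fun h => Summit.CriticalPhenomena.Ising3DConformalLimit.PerfectScreeningCoulombImpliesNontrivial.stub_gapOfBinderNonvanishing h⟩

/-! ## Strengthen -/

/-- **S⁺ (uniform block gap).** The gap at EVERY block size, not just frequently: for all `L ≥ 1` there is a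
zero `θ` of `⟨cos(θ M_L)⟩⁺_{β_c}` with `θ²Σ_L ≤ C`. Equivalent to `liminf_L g_L > 0`. [folklore] -/
def UniformBlockGap : Prop :=
  ∃ C : ℝ, ∀ L : ℕ, 1 ≤ L → ∃ θ : ℝ, 0 < θ ∧ θ ^ 2 * blockVar L ≤ C ∧
    plusExpect 3 (criticalBeta 3) 0 (fun σ => Real.cos (θ * ∑ x ∈ box 3 L, spinAt x σ)) = 0

/-- **What monotonicity actually gives (doubling with loss 64).** From volume antitonicity of the first zero
(`firstZero_box_antitone_volume`, CJN 2022) and `Σ_{2L} ≤ 64 Σ_L` (Cauchy–Schwarz in the positive-definite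
kernel `⟨σ_xσ_y⟩` over the 8 sub-blocks): a normalised zero at scale `L` produces one at scale `2L` with the
constant multiplied by `64`. Iterating gives `t₁(2^k L)² ≤ 64^k t₁(L)²` — no induction closes. [folklore] -/
def BlockGapDoublingLoss : Prop :=
  ∀ (L : ℕ) (C θ : ℝ), 1 ≤ L → 0 < θ → θ ^ 2 * blockVar L ≤ C →
    plusExpect 3 (criticalBeta 3) 0 (fun σ => Real.cos (θ * ∑ x ∈ box 3 L, spinAt x σ)) = 0 →
    ∃ θ' : ℝ, 0 < θ' ∧ θ' ≤ θ ∧ θ' ^ 2 * blockVar (2 * L) ≤ 64 * C ∧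
      plusExpect 3 (criticalBeta 3) 0 (fun σ => Real.cos (θ' * ∑ x ∈ box 3 (2 * L), spinAt x σ)) = 0

/-- **The missing inductive lemma (summable-loss contraction across one doubling).** This is what would make
`UniformBlockGap` provable by induction on dyadic scales. It asserts that the normalised first zero is almost
non-increasing under doubling — i.e. that `g_{2L} ≳ g_L` quantitatively — which is the uniform gap itself in
differential form; it is FALSE for `d ≥ 5` (there `t₁(L) → ∞` like `L^{(d-4)/4}`), so no dimension-uniform
monotonicity/convexity argument can prove it. [folklore] -/
def BlockGapContraction : Prop :=
  ∃ K κ : ℝ, 0 < κ ∧ ∀ (L : ℕ) (θ : ℝ), 1 ≤ L → 0 < θ →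
    plusExpect 3 (criticalBeta 3) 0 (fun σ => Real.cos (θ * ∑ x ∈ box 3 L, spinAt x σ)) = 0 →
    ∃ θ' : ℝ, 0 < θ' ∧
      plusExpect 3 (criticalBeta 3) 0 (fun σ => Real.cos (θ' * ∑ x ∈ box 3 (2 * L), spinAt x σ)) = 0 ∧
      θ' ^ 2 * blockVar (2 * L) ≤ θ ^ 2 * blockVar L * (1 + K * (L : ℝ) ^ (-κ))

/-! ## Decomposition candidates -/

/-- The lattice four-point Ursell function at criticality, `U₄(x) = ⟨σσσσ⟩ − Σ_pairings ⟨σσ⟩⟨σσ⟩` (plus state,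
`β_c(3)`, `h = 0`). [folklore] -/
def latticeU4 (x : Fin 4 → Site 3) : ℝ :=
  criticalCorr 3 4 x -
    (criticalTwoPoint 3 (x 1 - x 0) * criticalTwoPoint 3 (x 3 - x 2) +
      criticalTwoPoint 3 (x 2 - x 0) * criticalTwoPoint 3 (x 3 - x 1) +
      criticalTwoPoint 3 (x 3 - x 0) * criticalTwoPoint 3 (x 2 - x 1))

/-- **(U) Pointwise `U₄`-hyperscaling on the lattice** — the `ρ`-free lattice form of clause (iii): at every
large scale `R`, quadruples with all mutual distances in `[R, 8R]` have `|U₄| ≥ c·⟨σσ⟩⟨σσ⟩` (via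
`ursellFour_eq_doubleCurrent`: the two SOURCED single-current clusters meet with probability `≥ c/2`). This is
the content of crux stmt-0636's lattice target (`CurrentsIntersectUniformly`) and of the crux dirs
`WindowForcesU4`, `GapForcesFarMerging`, `InterlacingForcesU4`; given the route's residual `MoebiusLimitExists`
it supplies clause (iii) BY ITSELF, so as a "piece" of the present crux it is a change of crux, not a split. [folklore] -/
def PointwiseU4Hyperscaling : Prop :=
  ∃ c : ℝ, 0 < c ∧ ∃ R₀ : ℕ, ∀ R : ℕ, R₀ ≤ R → ∀ x : Fin 4 → Site 3,
    (∀ i j : Fin 4, i ≠ j → (R : ℝ) ≤ ‖x i - x j‖ ∧ ‖x i - x j‖ ≤ 8 * R) →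
    c * (criticalTwoPoint 3 (x 1 - x 0) * criticalTwoPoint 3 (x 3 - x 2)) ≤ - latticeU4 x

/-- **(χ₁') Susceptibility carried by the top scale, frequently**: `Σ_L ≤ C·L⁶·⟨σ₀σ_{6L e₀}⟩` for infinitely
many `L` (one-scale comparability; cf. item stmt-6032 / `OneScaleComparabilityAnatomy`, unconditional up to a
factor `n+1`). With (U) and Messager–Miracle-Solé it gives `limsup g_L > 0`, hence the crux — but (U) alone already
pays clause (iii). [folklore] -/
def SusceptibilityTopHeavyFrequently : Prop :=
  ∃ C : ℝ, ∃ᶠ L : ℕ in atTop,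
    blockVar L ≤ C * (L : ℝ) ^ 6 * criticalTwoPoint 3 (Pi.single (0 : Fin 3) (6 * (L : ℤ)))

/-! ## Weaker intermediate -/

/-- **The strictly weaker, CONDITIONAL intermediate** (by name): every non-degenerate pointwise scaling limit of
the critical correlators has `U₄ ≢ 0` — item stmt-CriticalPhenomena-0636, shared by ~25 routes. Vacuous if no
limit exists; implied by the crux (`Cruxes/IsingEuclidUpgradeR4NonGaussian/StrategistPayers.lean`). [folklore] -/
abbrev ConditionalNonGaussianity : Prop :=
  Summit.CriticalPhenomena.Ising3DConformalLimit.Theses.IsingEuclidUpgrade.IsingEuclidUpgradeR4NonGaussian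

/-- **Converse of item 4950 (why nothing weaker pays clause (iii)).** A non-degenerate, scale-covariant pointwise
limit whose `U₄` is non-zero AND continuous at one non-coincident configuration forces `g_L ↛ 0` (hence the crux,
by `gap_iff_binderNonvanishing`): `U₄^{lat} ≤ 0` pointwise (Lebowitz) so the `ε`-separated Riemann sum cannot be
cancelled, `|Σ_{Λ_L⁴}U₄| ≥ c L¹²ρ(1/L)⁻⁴`, while `Σ_L ≤ C L⁶ρ(1/L)⁻²` by the Potter/Karamata bound for the regularly
varying `r ↦ ⟨σ₀σ_{re}⟩` (same inputs as `gaussianLimitKillsBlockCoupling_proof`). So modulo the route's residual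
`MoebiusLimitExists` (+ this regularity) ANY statement that pays clause (iii) implies the crux. [folklore] -/
def NonGaussianLimitForcesGap : Prop :=
  ∀ (ρ : ℝ → ℝ) (Δ : ℝ) (S : CorrFamily 3), (∀ δ ∈ Set.Ioc (0:ℝ) 1, 0 < ρ δ) →
    HasPointwiseScalingLimit (criticalCorr 3) ρ S → IsNondegenerateTwoPoint S → IsScaleCovariant Δ S →
    (∃ x : Fin 4 → EuclideanSpace ℝ (Fin 3), Function.Injective x ∧
      ContinuousAt (S 4) x ∧
      S 4 x ≠ S 2 ![x 0, x 1] * S 2 ![x 2, x 3] + S 2 ![x 0, x 2] * S 2 ![x 1, x 3] +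
        S 2 ![x 0, x 3] * S 2 ![x 1, x 2]) →
    ¬ Tendsto binder atTop (𝓝 0)

/-- Sanity: the crux implies the conditional intermediate's hypothesis-free core "`g_L ↛ 0`" and is implied by
it — recorded as the two halves of `gap_iff_binderNonvanishing`; the uniform strengthening trivially implies the
crux. [folklore] -/
theorem gap_of_uniformBlockGap (h : UniformBlockGap) :
    Summit.CriticalPhenomena.Ising3DConformalLimit.Theses.LeeYangGap.NearCriticalLeeYangGap := by
  obtain ⟨C, hC⟩ := h
  refine ⟨C, Filter.frequently_atTop.2 fun N => ⟨max N 1, le_max_left _ _, ?_⟩⟩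
  obtain ⟨θ, hθ, hθC, hz⟩ := hC (max N 1) (le_max_right _ _)
  exact ⟨criticalBeta 3, θ, criticalBeta_nonneg 3, le_rfl, hθ, hθC, hz⟩

end Summit.CriticalPhenomena.Ising3DConformalLimit.Cruxes.NearCriticalLeeYangGap.CensusS1

end
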